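import Literature.MathematicalPhysics.QuantumFieldTheory.Balaban1983to89.B5Eq133G0Torus

/-!
# `Balaban1983to89.B5G0SettingTorus` — THE CONCRETE SETTING OF RECORD FOR G₀ = (Δ + aQ*Q)⁻¹ on Bałaban's tori:
# B5 Prop. 1.1/1.2's vocabulary ((1.89)–(1.90), (1.108)–(1.114), the cubes Δ̃(y)) instantiated, PER DIRECTION μ, for the
# scalar operator G₀^{(μ)} = `B5Eq133G0Torus.G0 P a m² k μ` on the SAME carrier as the G′-setting `B5GpSettingTorus.gpSetting`
# (so that the (1.133)-transfer `B5Transfer133.Carrier133` has σ = ι = κ = id), with the L² half INTERPRETED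

statement-level skeleton of published theorems with citation tags; proofs where landed; nothing here is a claim
about the Yang–Mills mass gap

Source (lit-balaban / pub-balaban cells): T. Bałaban, *Propagators and renormalization transformations for lattice
gauge theories. I*, Commun. Math. Phys. **95** (1984) 17–40 [`Balaban1984PropagatorsI`, "B5"], p. 33 [PDF 17]
(Prop. 1.1, (1.89)–(1.90)), pp. 35–36 [PDF 19–20] (Prop. 1.2, (1.108)–(1.114)), p. 39 [PDF 23] ((1.132)–(1.134)); held as
`paper:balaban1984-cmp95-propagators-rt-i`; the displays are quoted verbatim in `B5` (`Setting`, `Prop11Printed`,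
`Ineq110_114`), `B5GpSettingTorus` (module docstring) and `B5Eq133G0Torus`.

## WHAT IS PRINTED (verbatim, the sentences this module serves)

p. 39 [PDF 23]: «where G₀ = (Δ + aQ*Q)⁻¹. This operator is similar to G′, but with the different averaging operator. We
will prove (1.115)–(1.117), and in fact the whole Proposition 1.2, for the operator G₀. … Properties of the operator G₀
can be easily reduced to the corresponding properties of the operator G′ by the equality G₀ = G′ + G′(a_kQ′*Q′ − aQ*Q)G₀.
(1.133) We only have to know some weak bounds for G₀, for example bounds in the L²-norm (1.89), or (1.114). … Thus its
momentum representation is given by (1.87) and we have Proposition 1.1 for G₀.»  Prop. 1.1 p. 33: «The operator G is a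
symmetric operator on L²(T_η) and ‖GJ‖, ‖∇GJ‖, ‖G∇*J‖, ‖∇G∇*J‖, ‖∇∇GJ‖, ‖G∇*∇*J‖ ≤ γ₀⁻¹‖J‖, (1.89) … This implies the
bound from below: Δ_a = G⁻¹ ≥ γ₀(Δ + I). (1.90)»  Prop. 1.2 pp. 35–36: (1.110)–(1.113) as quoted in `B5GpSettingTorus`, and
«‖ζGJ‖, ‖ζ∇GJ‖, ‖ζG∇*J‖, ‖ζ∇G∇*J‖, ‖ζ∇∇GJ‖, ‖ζG∇*∇*J‖ ≤ O(1)e^{−δ₀|y−y′|}|ζ|‖J‖ (1.114) for supp ζ ⊂ Δ̃(y),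
supp J ⊂ Δ̃(y′)».

## THE READING (per direction), and the dictionary

By `B5Eq133G0Torus` (module docstring) B5's G₀ on vector fields over T_η is the direct sum over the directions μ of the
d scalar operators G₀^{(μ)} = `G0 P a m² k μ` = (−Δ^η + (L^kε)²m² + aQ*_μQ_μ)⁻¹ (B5: m² = 0; k ≤ m + K; η = L^{−k}), and
(1.133) holds direction by direction with THE SAME scalar operator G′ = G′_k.  Accordingly Propositions 1.1/1.2 for G₀ are
read, exactly as they are read for the scalar operator G′ in `B5GpSettingTorus.gpSetting`, FOR EACH SCALAR OPERATOR
G₀^{(μ)} SEPARATELY, on the same arguments: vector sources `J : Fin P.d → Site P 0 → ℝ` (|J|, ‖J‖_α of (1.108)–(1.109),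
‖J‖ of L²(T_η)), cut-offs `ζ : Site P 0 → ℝ`, unit lattice `Site P k`, cubes Δ̃(y) (`inCube`), distances `T P k` — the
operator acting on each component J_ν ((G₀^{(μ)}J)_ν = G₀^{(μ)}J_ν, (∇G₀^{(μ)}J)_{λν} = ∂^η_λG₀^{(μ)}J_ν,
G₀^{(μ)}∇*J = Σ_ν G₀^{(μ)}∂^{η*}_νJ_ν, (∇G₀^{(μ)}∇*J)_λ, (∇∇G₀^{(μ)}J)_{λλ′ν}, ΔG₀^{(μ)}J_ν with Δ = −Δ^η ≥ 0 (p. 22)).  The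
family over (torus, μ) of these scalar-operator statements is EQUIVALENT to the printed statements for the vector
operator G₀ = ⊕_μ G₀^{(μ)} (a bound for the direct sum is the maximum over μ of the bounds for the summands; the vector
operator's tensor sources for ∇* are, column by column, the vector sources here), and it is the form in which the
(1.133)-transfer from G′ is literally entrywise.  The construction is written for an ARBITRARY scalar operator
`G : Matrix (Site P 0) (Site P 0) ℝ` and form operator `Gi` (`opSetting P k G Gi`) and then specialised
(`g0Setting P a m² k μ := opSetting P k (G0 P a m² k μ) (M0 P a m² k μ)`); ∂^η_μ = `dEta P k μ = deriv P 0 (ε/(L^kε)) μ`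
(the tree's convention of `B5Display135Torus.E1_eq`), ∂^{η*} = transpose (U = 1), −Δ^η = `lapEta P k = hOp P 0 (ε/(L^kε)) 0`.

THE L² HALF IS INTERPRETED here (for G′ it is a free parameter, B5 needing (1.89)/(1.114) for G and G₀ only): `l2op n J` =
the L²(T_η) norms ‖G^{(μ)}J‖, ‖∇G^{(μ)}J‖, ‖G^{(μ)}∇*J‖, ‖∇G^{(μ)}∇*J‖, ‖∇∇G^{(μ)}J‖ of the families above (η^d-weighted ℓ²
norms `l2Fam`, = `l2NormV` on vector families), `l2loc n J ζ` = the same with the factor ζ(x) inside ((1.114)); `Vec` =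
scalar functions on T_η (the μ-th component of a vector field), `formΔa f` = ⟨f, G₀^{(μ)−1}f⟩_{L²(T_η)} = η^dΣ_x f·(M0 f)
(«Δ_a = G⁻¹» read for G₀: G₀⁻¹ = Δ + aQ*Q), `formΔI f` = ⟨f, (Δ + I)f⟩_{L²(T_η)}.
DIVERGENCE T (disclosed): (1.111) is printed «for 0 ≤ α < 1» and Prop. 1.2's typed form (`B5.Ineq110_114`,
`B5FromB4.H1Entry`) quantifies exactly that range; the record field `h1 : Loc → ℝ → Cut → ℝ` is total, and this setting
puts `h1 J α ζ := max(‖ζ∇GJ‖_α, ‖ζG∇*J‖_α)` for α ≤ 1 and `0` for α > 1, where B5 states nothing (reason: the located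
leaf `B5Transfer133.Display133` used for the (1.133)-transfer quantifies its Hölder clause over ALL real α, and for α > 1
the lattice Hölder quotient of ζ·G′(piece) is not controlled by first-order sup entries uniformly in η — the mean-value
step gives |x − x′|^{1−α}; every consumer (`H1Entry`, `Prop12Printed`) reads h1 only at 0 ≤ α < 1, `opSetting_h1_of_le`).
DIVERGENCE (disclosed): the SIXTH members ‖G∇*∇*J‖ of (1.89) and ‖ζG∇*∇*J‖ of (1.114) act on 2-TENSOR sources and have
no instance on the vector sources of this carrier; `l2op 5 := 0`, `l2loc 5 := 0` (no printed content typed there — the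
same convention as `B5Prop11SettingModel.l2op189` on the summands where an operator does not act); they are not used by
the (1.133)-transfer (`B5Transfer133.pIdx = ![0, 0, 2, 0]`).

## WHAT THIS MODULE PROVIDES (zero sorry)

§1 the kernels `dEta`, `lapEta`, `opK0/opKD/opK1/opKL/opKDD`, `opDiv`, `opDD` of a scalar operator G; §2 the entries
`opEntry` (1.110), `opHD`/`opHS` (1.111), `opE4` (1.112), `opH2` (1.113), the L² half `l2Fam`, `opL2` (1.89), `opL2loc`
(1.114), the forms `formOp`; §3 `opSetting`, `g0Setting`, the unfolding lemmas, the top-level readings (k = K: ∂^η = ∂^ε,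
−Δ^η = `H P 0`, `dEta_top`, `lapEta_top`); §4 THE MODEL SIGNS `modelSigns_opSetting`/`modelSigns_g0Setting`
(`B5FromB4.ModelSigns`, theorems of the concrete norms) and THE CUBE FACTS `cubeFacts_opSetting` (c = 2), the entry bounds
`opEntry_zero_le`/`opEntry_one_le` from pointwise bounds, and non-negativity of every entry and L² quantity; §5 the
families of record `famG0 P a m² k μ` over arbitrary index types and `famG0Top d L a m²` over (torus with P.d = d,
P.L = L, 1 ≤ K) × direction, with their signs.

## HONEST SCOPE

(v1.1: the `h1` field of `opSetting` restricted to α ≤ 1 — DIVERGENCE T above —, `opSetting_h1_of_le`, `opSetting_h1_nonneg`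
added; nothing else changed w.r.t. v1 = p259050.)  Definitions and model-evident facts only: NO entry of Prop. 1.1/1.2 for G₀ is proved here («Proposition 1.1 for G₀» is
r02's `B5Prop11G0Torus` on the matrix presentation, to be transported; Prop. 1.2 for G₀ is the (1.133)-transfer, a separate
file).  U = 1; the tori of `Setup`; m² ≥ 0 a parameter (B5: 0).  CELL BOOK-KEEPING (lit-balaban): rows B5.Prop1.2 census
(vii)/(iv) and B5.Eq1.134 of ROWS-B5 (owner r02, referee ref-4); VALUE = the vocabulary in which the located «easily reduced …
by the equality (1.133)» becomes checkable for Bałaban's actual operators, NOT summit progress.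
-/

namespace Literature.MathematicalPhysics.QuantumFieldTheory.Balaban1983to89

open Matrix

noncomputable section

namespace B5G0SettingTorus

open B1RG242Torus B5Ineq137Torus B5GpSettingTorus B5Eq133G0Torus B5Display136Torus B5Display135Torus

variable (P : Params)

/-! ## §1 The kernels of a scalar operator `G` on T_η, η = L^{−k} -/

/-- **∂^η_μ** on T_η in the tower's coordinates: `deriv P 0 (ε/(L^kε)) μ` = (L^kε)·∂^ε_μ, i.e. η^{−1}(f(x + ηe_μ) − f(x))
(the convention of `B5Display135Torus.E1_eq`; at k = K it is ∂^ε_μ, `dEta_top`). [cite: Balaban1984PropagatorsI, (1.31) p.23, (1.108) p.35] -/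
def dEta (k : ℕ) (μ : Fin P.d) : Matrix (Site P 0) (Site P 0) ℝ := deriv P 0 (P.eps / P.spacing k) μ

/-- **Δ = −Δ^η = Σ_μ ∂^{η*}_μ∂^η_μ**, «η-lattice Laplace operator for scalar functions … a symmetric, non-negative operator»
(massless). [cite: Balaban1984PropagatorsI, p.21–22] -/
def lapEta (k : ℕ) : Matrix (Site P 0) (Site P 0) ℝ := hOp P 0 (P.eps / P.spacing k) 0

/-- At the top level k = K (L^Kε = 1, η = ε): ∂^η_μ = ∂^ε_μ. [cite: Balaban1984PropagatorsI, (1.108) p.35] -/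
theorem dEta_top (μ : Fin P.d) : dEta P P.K μ = deriv P 0 P.eps μ := by
  rw [dEta, P.spacing_K, div_one]

/-- At the top level k = K: −Δ^η = the tower's massless `H P 0`. [cite: Balaban1984PropagatorsI, p.21] -/
theorem lapEta_top : lapEta P P.K = H P 0 := by
  rw [lapEta, H, P.spacing_K, div_one]

section Kernels

variable (k : ℕ) (G : Matrix (Site P 0) (Site P 0) ℝ)

/-- `(Gf)(x)`. [cite: Balaban1984PropagatorsI, (1.110) p.35] -/
def opK0 (f : Site P 0 → ℝ) (x : Site P 0) : ℝ := (G *ᵥ f) x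

/-- `(∂_μGf)(x)`. [cite: Balaban1984PropagatorsI, (1.110) p.35] -/
def opKD (μ : Fin P.d) (f : Site P 0 → ℝ) (x : Site P 0) : ℝ := ((dEta P k μ * G) *ᵥ f) x

/-- `(G∂*_νf)(x)` (∂* = transpose, U = 1). [cite: Balaban1984PropagatorsI, (1.110) p.35] -/
def opK1 (ν : Fin P.d) (f : Site P 0 → ℝ) (x : Site P 0) : ℝ := ((G * (dEta P k ν)ᵀ) *ᵥ f) x

/-- `(ΔGf)(x)`, Δ = −Δ^η. [cite: Balaban1984PropagatorsI, (1.110) p.35] -/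
def opKL (f : Site P 0 → ℝ) (x : Site P 0) : ℝ := ((lapEta P k * G) *ᵥ f) x

/-- `(∂_μG∂*_νf)(x)`. [cite: Balaban1984PropagatorsI, (1.112) p.36] -/
def opKDD (μ ν : Fin P.d) (f : Site P 0 → ℝ) (x : Site P 0) : ℝ := ((dEta P k μ * G * (dEta P k ν)ᵀ) *ᵥ f) x

/-- `(∂_μ∂_{μ′}Gf)(x)` (the fifth member ∇∇GJ of (1.89)/(1.114)). [cite: Balaban1984PropagatorsI, (1.89) p.33, (1.114) p.36] -/
def opKD2 (μ μ' : Fin P.d) (f : Site P 0 → ℝ) (x : Site P 0) : ℝ := ((dEta P k μ * dEta P k μ' * G) *ᵥ f) x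

/-- **(G∇*J)(x) = Σ_ν (G∂*_νJ_ν)(x)** («∂*A = Σ_μ ∂*_μA_μ», p. 21). [cite: Balaban1984PropagatorsI, (1.110) p.35, p.21] -/
def opDiv (J : Fin P.d → Site P 0 → ℝ) (x : Site P 0) : ℝ := ∑ ν, opK1 P k G ν (J ν) x

/-- **(∇G∇*J)_μ(x) = Σ_ν (∂_μG∂*_νJ_ν)(x)**. [cite: Balaban1984PropagatorsI, (1.112) p.36] -/
def opDD (J : Fin P.d → Site P 0 → ℝ) (μ : Fin P.d) (x : Site P 0) : ℝ := ∑ ν, opKDD P k G μ ν (J ν) x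

/-! ## §2 The entries (1.110)–(1.113), the L² half (1.89)/(1.114), the forms (1.90) — for the scalar operator `G` -/

/-- **The four sup entries of (1.110) for G** over Δ̃(y): n = 0 ↦ max_ν|(GJ_ν)(x)|, n = 1 ↦ max_{λ,ν}|(∂_λGJ_ν)(x)|,
n = 2 ↦ |(G∇*J)(x)|, n = 3 ↦ max_ν|(ΔGJ_ν)(x)| (the shapes of `B5GpSettingTorus.entry`). [cite: Balaban1984PropagatorsI, (1.110) p.35] -/
def opEntry (n : Fin 4) (J : Fin P.d → Site P 0 → ℝ) (y : Site P k) : ℝ :=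
  match n with
  | ⟨0, _⟩ => cubeSup P k y (dir0 P) (fun ν => opK0 P G (J ν))
  | ⟨1, _⟩ => cubeSup P k y (dir0 P, dir0 P) (fun p : Fin P.d × Fin P.d => opKD P k G p.1 (J p.2))
  | ⟨2, _⟩ => cubeSup P k y () (fun _ : Unit => opDiv P k G J)
  | ⟨3, _⟩ => cubeSup P k y (dir0 P) (fun ν => opKL P k G (J ν))

/-- **‖ζ∇GJ‖_α = max_{λ,ν}‖ζ·∂_λGJ_ν‖_α** (first quantity of (1.111)). [cite: Balaban1984PropagatorsI, (1.111) p.35] -/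
def opHD (J : Fin P.d → Site P 0 → ℝ) (α : ℝ) (ζ : Site P 0 → ℝ) : ℝ :=
  (Finset.univ : Finset (Fin P.d × Fin P.d)).sup' ⟨(dir0 P, dir0 P), Finset.mem_univ _⟩
    (fun p => holN P k α (fun x => ζ x * opKD P k G p.1 (J p.2) x))

/-- **‖ζG∇*J‖_α** (second quantity of (1.111)). [cite: Balaban1984PropagatorsI, (1.111) p.35] -/
def opHS (J : Fin P.d → Site P 0 → ℝ) (α : ℝ) (ζ : Site P 0 → ℝ) : ℝ :=
  holN P k α (fun x => ζ x * opDiv P k G J x)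

/-- **sup_{x∈Δ̃(y)}|(∇G∇*J)(x)| = sup over Δ̃(y) of max_μ|(∇G∇*J)_μ(x)|** (1.112). [cite: Balaban1984PropagatorsI, (1.112) p.36] -/
def opE4 (J : Fin P.d → Site P 0 → ℝ) (y : Site P k) : ℝ := cubeSup P k y (dir0 P) (opDD P k G J)

/-- **‖ζ∇G∇*J‖_α = max_μ‖ζ·(∇G∇*J)_μ‖_α** (1.113). [cite: Balaban1984PropagatorsI, (1.113) p.36] -/
def opH2 (J : Fin P.d → Site P 0 → ℝ) (α : ℝ) (ζ : Site P 0 → ℝ) : ℝ :=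
  (Finset.univ : Finset (Fin P.d)).sup' ⟨dir0 P, Finset.mem_univ _⟩
    (fun μ => holN P k α (fun x => ζ x * opDD P k G J μ x))

end Kernels

/-- **The L²(T_η) norm of a finite family of scalar functions**: ‖F‖ = (Σ_i Σ_x η^d F_i(x)²)^{1/2} — the norm ‖·‖ of
(1.89)/(1.114) for vector (i = ν), tensor (i = (λ,ν)), … valued functions; on vector families it is `l2NormV`
(`l2NormV_eq_l2Fam`). [cite: Balaban1984PropagatorsI, (1.89) p.33] -/
def l2Fam (k : ℕ) {ι : Type} [Fintype ι] (F : ι → Site P 0 → ℝ) : ℝ :=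
  Real.sqrt (∑ i, ∑ x, (((P.L : ℝ) ^ k)⁻¹) ^ P.d * (F i x) ^ 2)

/-- The vector-field norm ‖J‖ of the carrier is `l2Fam` (definitional). [cite: Balaban1984PropagatorsI, (1.89) p.33] -/
theorem l2NormV_eq_l2Fam (k : ℕ) (J : Fin P.d → Site P 0 → ℝ) : l2NormV P k J = l2Fam P k J := rfl

/-- `0 ≤ ‖F‖`. [cite: Balaban1984PropagatorsI, (1.89) p.33] -/
theorem l2Fam_nonneg (k : ℕ) {ι : Type} [Fintype ι] (F : ι → Site P 0 → ℝ) : 0 ≤ l2Fam P k F := Real.sqrt_nonneg _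

section L2

variable (k : ℕ) (G : Matrix (Site P 0) (Site P 0) ℝ)

/-- **The six norms of (1.89) for the scalar operator G on vector sources**: n = 0 ‖GJ‖ (ν ↦ GJ_ν), n = 1 ‖∇GJ‖
((λ,ν) ↦ ∂_λGJ_ν), n = 2 ‖G∇*J‖, n = 3 ‖∇G∇*J‖ (λ ↦ (∇G∇*J)_λ), n = 4 ‖∇∇GJ‖ ((λ,λ′,ν) ↦ ∂_λ∂_{λ′}GJ_ν), and n = 5
(‖G∇*∇*J‖, 2-tensor sources) := 0 — DIVERGENCE disclosed in the module docstring. [cite: Balaban1984PropagatorsI, Prop. 1.1 (1.89) p.33] -/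
def opL2 (n : Fin 6) (J : Fin P.d → Site P 0 → ℝ) : ℝ :=
  match n with
  | ⟨0, _⟩ => l2Fam P k (fun ν => G *ᵥ J ν)
  | ⟨1, _⟩ => l2Fam P k (fun p : Fin P.d × Fin P.d => (dEta P k p.1 * G) *ᵥ J p.2)
  | ⟨2, _⟩ => l2Fam P k (fun _ : Unit => opDiv P k G J)
  | ⟨3, _⟩ => l2Fam P k (opDD P k G J)
  | ⟨4, _⟩ => l2Fam P k (fun p : (Fin P.d × Fin P.d) × Fin P.d => (dEta P k p.1.1 * dEta P k p.1.2 * G) *ᵥ J p.2)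
  | ⟨5, _⟩ => 0

/-- **The six localized norms of (1.114) for G on vector sources**: ‖ζ·(−)‖ of the same six families (n = 5 := 0, as for
`opL2`). [cite: Balaban1984PropagatorsI, (1.114) p.36] -/
def opL2loc (n : Fin 6) (J : Fin P.d → Site P 0 → ℝ) (ζ : Site P 0 → ℝ) : ℝ :=
  match n with
  | ⟨0, _⟩ => l2Fam P k (fun ν x => ζ x * (G *ᵥ J ν) x)
  | ⟨1, _⟩ => l2Fam P k (fun (p : Fin P.d × Fin P.d) x => ζ x * ((dEta P k p.1 * G) *ᵥ J p.2) x)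
  | ⟨2, _⟩ => l2Fam P k (fun (_ : Unit) x => ζ x * opDiv P k G J x)
  | ⟨3, _⟩ => l2Fam P k (fun μ x => ζ x * opDD P k G J μ x)
  | ⟨4, _⟩ => l2Fam P k (fun (p : (Fin P.d × Fin P.d) × Fin P.d) x =>
      ζ x * ((dEta P k p.1.1 * dEta P k p.1.2 * G) *ᵥ J p.2) x)
  | ⟨5, _⟩ => 0

end L2

/-- **The quadratic form ⟨f, Bf⟩ of L²(T_η)** (weight η^d): `η^d Σ_x f(x)(Bf)(x)` — for B = G₀⁻¹ = Δ + aQ*Q this is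
«⟨A, Δ_aA⟩» of (1.90) read for G₀ (one component), for B = Δ + I it is ⟨A, (Δ + I)A⟩. [cite: Balaban1984PropagatorsI, (1.90) p.33] -/
def formOp (k : ℕ) (B : Matrix (Site P 0) (Site P 0) ℝ) (f : Site P 0 → ℝ) : ℝ :=
  (((P.L : ℝ) ^ k)⁻¹) ^ P.d * (f ⬝ᵥ (B *ᵥ f))

/-! ## §3 The settings -/

/-- **B5's Prop. 1.1/1.2 vocabulary for a scalar operator `G` on T_η (form operator `Gi` for (1.90)) on the carrier of
`B5GpSettingTorus.gpSetting`** — same sites, distances, sources, supports, norms, cut-offs; entries, L² half and forms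
those of §2. [cite: Balaban1984PropagatorsI, Prop. 1.1 (1.89)–(1.90) p.33, Prop. 1.2 (1.108)–(1.114) pp.35–36] -/
def opSetting (k : ℕ) (G Gi : Matrix (Site P 0) (Site P 0) ℝ) : B5.Setting where
  Site := Site P k
  dist := T P k
  k := k
  Loc := Fin P.d → Site P 0 → ℝ
  suppIn := fun J y' => ∀ ν x, J ν x ≠ 0 → inCube P k x y'
  supNorm := supNormV P
  l2Norm := l2NormV P k
  holder := holderV P k
  Cut := Site P 0 → ℝ
  cutIn := fun ζ y => ∀ x, ζ x ≠ 0 → inCube P k x y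
  cutH := cutHV P k
  cutSup := supN P
  l2op := opL2 P k G
  e := opEntry P k G
  h1 := fun J α ζ => if α ≤ 1 then max (opHD P k G J α ζ) (opHS P k G J α ζ) else 0
  e4 := opE4 P k G
  h2 := opH2 P k G
  l2loc := opL2loc P k G
  Vec := Site P 0 → ℝ
  formΔa := formOp P k Gi
  formΔI := formOp P k (lapEta P k + 1)

/-- **THE CONCRETE SETTING OF RECORD FOR G₀, DIRECTION μ**: the vocabulary instantiated for G₀^{(μ)} = `G0 P a m² k μ`
= (−Δ^η + (L^kε)²m² + aQ*_μQ_μ)⁻¹, with (1.90)'s «Δ_a = G⁻¹» the operator `M0 P a m² k μ` = G₀^{(μ)−1}.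
[cite: Balaban1984PropagatorsI, (1.132)–(1.133) p.39, Prop. 1.2 (1.108)–(1.114) pp.35–36] -/
def g0Setting (a msq : ℝ) (k : ℕ) (μ : Fin P.d) : B5.Setting := opSetting P k (G0 P a msq k μ) (M0 P a msq k μ)

section Unfold

variable (k : ℕ) (G Gi : Matrix (Site P 0) (Site P 0) ℝ)

/-- unfolding: the sites are `T₁^{(k)}`. [cite: Balaban1984PropagatorsI, p.35] -/
@[simp] theorem opSetting_Site : (opSetting P k G Gi).Site = Site P k := rfl
/-- unfolding: the level. [cite: Balaban1984PropagatorsI, p.35] -/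
@[simp] theorem opSetting_k : (opSetting P k G Gi).k = k := rfl
/-- unfolding: the sources are vector fields on T_η. [cite: Balaban1984PropagatorsI, (1.108) p.35] -/
@[simp] theorem opSetting_Loc : (opSetting P k G Gi).Loc = (Fin P.d → Site P 0 → ℝ) := rfl
/-- unfolding: the cut-offs are functions on T_η. [cite: Balaban1984PropagatorsI, (1.111) p.35] -/
@[simp] theorem opSetting_Cut : (opSetting P k G Gi).Cut = (Site P 0 → ℝ) := rfl
/-- unfolding: `Vec` = scalar functions on T_η (one component). [cite: Balaban1984PropagatorsI, (1.90) p.33] -/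
@[simp] theorem opSetting_Vec : (opSetting P k G Gi).Vec = (Site P 0 → ℝ) := rfl
/-- unfolding: |y − y′|. [cite: Balaban1984PropagatorsI, (1.110) p.35] -/
@[simp] theorem opSetting_dist (y y' : Site P k) : (opSetting P k G Gi).dist y y' = T P k y y' := rfl
/-- unfolding: |J|. [cite: Balaban1984PropagatorsI, (1.108) p.35] -/
@[simp] theorem opSetting_supNorm (J : Fin P.d → Site P 0 → ℝ) : (opSetting P k G Gi).supNorm J = supNormV P J := rfl
/-- unfolding: ‖J‖. [cite: Balaban1984PropagatorsI, (1.89) p.33] -/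
@[simp] theorem opSetting_l2Norm (J : Fin P.d → Site P 0 → ℝ) : (opSetting P k G Gi).l2Norm J = l2NormV P k J := rfl
/-- unfolding: ‖J‖_ε. [cite: Balaban1984PropagatorsI, (1.109) p.35] -/
@[simp] theorem opSetting_holder (ε : ℝ) (J : Fin P.d → Site P 0 → ℝ) :
    (opSetting P k G Gi).holder ε J = holderV P k ε J := rfl
/-- unfolding: ‖ζ‖_α + |ζ|. [cite: Balaban1984PropagatorsI, (1.111) p.35] -/
@[simp] theorem opSetting_cutH (α : ℝ) (ζ : Site P 0 → ℝ) : (opSetting P k G Gi).cutH α ζ = cutHV P k α ζ := rfl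
/-- unfolding: |ζ|. [cite: Balaban1984PropagatorsI, (1.114) p.36] -/
@[simp] theorem opSetting_cutSup (ζ : Site P 0 → ℝ) : (opSetting P k G Gi).cutSup ζ = supN P ζ := rfl
/-- unfolding: the sup entries. [cite: Balaban1984PropagatorsI, (1.110) p.35] -/
@[simp] theorem opSetting_e (n : Fin 4) (J : Fin P.d → Site P 0 → ℝ) (y : Site P k) :
    (opSetting P k G Gi).e n J y = opEntry P k G n J y := rfl
/-- unfolding: h1 = max(‖ζ∇GJ‖_α, ‖ζG∇*J‖_α) on the exponents α ≤ 1 (⊇ the printed range 0 ≤ α < 1 of (1.111)), 0 beyond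
(DIVERGENCE T, module docstring). [cite: Balaban1984PropagatorsI, (1.111) p.35] -/
@[simp] theorem opSetting_h1 (J : Fin P.d → Site P 0 → ℝ) (α : ℝ) (ζ : Site P 0 → ℝ) :
    (opSetting P k G Gi).h1 J α ζ = if α ≤ 1 then max (opHD P k G J α ζ) (opHS P k G J α ζ) else 0 := rfl
/-- unfolding on the printed range: for α ≤ 1 (in particular 0 ≤ α < 1), h1 = max(‖ζ∇GJ‖_α, ‖ζG∇*J‖_α).
[cite: Balaban1984PropagatorsI, (1.111) p.35] -/
theorem opSetting_h1_of_le (J : Fin P.d → Site P 0 → ℝ) {α : ℝ} (hα : α ≤ 1) (ζ : Site P 0 → ℝ) :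
    (opSetting P k G Gi).h1 J α ζ = max (opHD P k G J α ζ) (opHS P k G J α ζ) := if_pos hα
/-- unfolding: e4. [cite: Balaban1984PropagatorsI, (1.112) p.36] -/
@[simp] theorem opSetting_e4 (J : Fin P.d → Site P 0 → ℝ) (y : Site P k) :
    (opSetting P k G Gi).e4 J y = opE4 P k G J y := rfl
/-- unfolding: h2. [cite: Balaban1984PropagatorsI, (1.113) p.36] -/
@[simp] theorem opSetting_h2 (J : Fin P.d → Site P 0 → ℝ) (α : ℝ) (ζ : Site P 0 → ℝ) :
    (opSetting P k G Gi).h2 J α ζ = opH2 P k G J α ζ := rfl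
/-- unfolding: the six norms (1.89). [cite: Balaban1984PropagatorsI, (1.89) p.33] -/
@[simp] theorem opSetting_l2op (n : Fin 6) (J : Fin P.d → Site P 0 → ℝ) :
    (opSetting P k G Gi).l2op n J = opL2 P k G n J := rfl
/-- unfolding: the six localized norms (1.114). [cite: Balaban1984PropagatorsI, (1.114) p.36] -/
@[simp] theorem opSetting_l2loc (n : Fin 6) (J : Fin P.d → Site P 0 → ℝ) (ζ : Site P 0 → ℝ) :
    (opSetting P k G Gi).l2loc n J ζ = opL2loc P k G n J ζ := rfl
/-- unfolding: ⟨f, G⁻¹f⟩. [cite: Balaban1984PropagatorsI, (1.90) p.33] -/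
@[simp] theorem opSetting_formΔa (f : Site P 0 → ℝ) : (opSetting P k G Gi).formΔa f = formOp P k Gi f := rfl
/-- unfolding: ⟨f, (Δ + I)f⟩. [cite: Balaban1984PropagatorsI, (1.90) p.33] -/
@[simp] theorem opSetting_formΔI (f : Site P 0 → ℝ) :
    (opSetting P k G Gi).formΔI f = formOp P k (lapEta P k + 1) f := rfl
/-- unfolding: supp J ⊂ Δ̃(y′). [cite: Balaban1984PropagatorsI, (1.110) p.35] -/
theorem opSetting_suppIn (J : Fin P.d → Site P 0 → ℝ) (y' : Site P k) :
    (opSetting P k G Gi).suppIn J y' ↔ ∀ ν x, J ν x ≠ 0 → inCube P k x y' := Iff.rfl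
/-- unfolding: ζ ∈ C₀^∞(Δ̃(y)). [cite: Balaban1984PropagatorsI, (1.111) p.35] -/
theorem opSetting_cutIn (ζ : Site P 0 → ℝ) (y : Site P k) :
    (opSetting P k G Gi).cutIn ζ y ↔ ∀ x, ζ x ≠ 0 → inCube P k x y := Iff.rfl

/-- **The G₀-setting and the G′-setting live on ONE carrier**: sites, distances, sources, supports, norms and cut-offs of
`g0Setting P a m² k μ` are those of `gpSetting P a m² k o` (definitionally) — the maps σ, ι, κ of `B5Transfer133.Carrier133`
between them are identities. [cite: Balaban1984PropagatorsI, (1.133) p.39] -/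
theorem g0Setting_carrier (a msq : ℝ) (μ : Fin P.d) (o : L2Half P) :
    (g0Setting P a msq k μ).Site = (gpSetting P a msq k o).Site ∧ (g0Setting P a msq k μ).Loc = (gpSetting P a msq k o).Loc ∧
      (g0Setting P a msq k μ).Cut = (gpSetting P a msq k o).Cut :=
  ⟨rfl, rfl, rfl⟩

/-- unfolding: the entries of the G₀-setting are those of the scalar operator `G0 P a m² k μ`. [cite: Balaban1984PropagatorsI, (1.110) p.35] -/
theorem g0Setting_e (a msq : ℝ) (μ : Fin P.d) (n : Fin 4) (J : Fin P.d → Site P 0 → ℝ) (y : Site P k) :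
    (g0Setting P a msq k μ).e n J y = opEntry P k (G0 P a msq k μ) n J y := rfl

/-- unfolding: ‖G₀^{(μ)}J‖ = the L²(T_η) norm of ν ↦ G₀^{(μ)}J_ν. [cite: Balaban1984PropagatorsI, (1.89) p.33] -/
theorem g0Setting_l2op_zero (a msq : ℝ) (μ : Fin P.d) (J : Fin P.d → Site P 0 → ℝ) :
    (g0Setting P a msq k μ).l2op 0 J = l2NormV P k (fun ν => G0 P a msq k μ *ᵥ J ν) := rfl

/-- unfolding: «Δ_a = G⁻¹» read for G₀ — the form of (1.90) is ⟨f, (Δ + aQ*Q)f⟩ (direction μ). [cite: Balaban1984PropagatorsI, (1.90) p.33, (1.132) p.39] -/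
theorem g0Setting_formΔa (a msq : ℝ) (μ : Fin P.d) (f : Site P 0 → ℝ) :
    (g0Setting P a msq k μ).formΔa f = (((P.L : ℝ) ^ k)⁻¹) ^ P.d * (f ⬝ᵥ (M0 P a msq k μ *ᵥ f)) := rfl

/-- unfolding: ⟨f, (Δ + I)f⟩. [cite: Balaban1984PropagatorsI, (1.90) p.33] -/
theorem g0Setting_formΔI (a msq : ℝ) (μ : Fin P.d) (f : Site P 0 → ℝ) :
    (g0Setting P a msq k μ).formΔI f = (((P.L : ℝ) ^ k)⁻¹) ^ P.d * (f ⬝ᵥ ((lapEta P k + 1) *ᵥ f)) := rfl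

end Unfold

/-! ## §4 Signs, cube facts, entry bounds -/

variable {P}

/-- **The model signs** (`B5FromB4.ModelSigns`) of the scalar-operator setting: distances, sup / L² / Hölder norms and the
cut-off functionals are non-negative — the carrier's theorems (`B5GpSettingTorus.modelSigns_gpSetting`).
[cite: Balaban1984PropagatorsI, (1.108)–(1.109) p.35] -/
theorem modelSigns_opSetting (k : ℕ) (G Gi : Matrix (Site P 0) (Site P 0) ℝ) :
    B5FromB4.ModelSigns (opSetting P k G Gi) where
  dist_nonneg := fun y y' => T_nonneg P k y y'
  supNorm_nonneg := fun J => supNormV_nonneg J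
  l2Norm_nonneg := fun _ => Real.sqrt_nonneg _
  holder_nonneg := fun ε J => holderV_nonneg k ε J
  cutH_nonneg := fun α ζ => cutHV_nonneg k α ζ
  cutSup_nonneg := fun ζ => supN_nonneg P ζ

/-- The model signs of the G₀-setting. [cite: Balaban1984PropagatorsI, (1.108)–(1.109) p.35] -/
theorem modelSigns_g0Setting (a msq : ℝ) (k : ℕ) (μ : Fin P.d) : B5FromB4.ModelSigns (g0Setting P a msq k μ) :=
  modelSigns_opSetting k _ _

/-- **The two cube facts of p. 35, c = 2** (`B5Ineq137Torus.cubeFacts_model` at the identity identification of the sites).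
[cite: Balaban1984PropagatorsI, p.35 (the cubes Δ̃(y))] -/
theorem cubeFacts_opSetting {k : ℕ} (hk : k ≤ P.m + P.K) (G Gi : Matrix (Site P 0) (Site P 0) ℝ) :
    CubeFacts P (opSetting P k G Gi) (inCube P k) 2 :=
  cubeFacts_model (S := opSetting P k G Gi) hk id (fun _ _ => rfl)

/-- The cube facts of the G₀-setting. [cite: Balaban1984PropagatorsI, p.35 (the cubes Δ̃(y))] -/
theorem cubeFacts_g0Setting (a msq : ℝ) {k : ℕ} (hk : k ≤ P.m + P.K) (μ : Fin P.d) :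
    CubeFacts P (g0Setting P a msq k μ) (inCube P k) 2 :=
  cubeFacts_opSetting hk _ _

section Bounds

variable {k : ℕ} (G : Matrix (Site P 0) (Site P 0) ℝ)

/-- Every sup entry is non-negative. [cite: Balaban1984PropagatorsI, (1.110) p.35] -/
theorem opEntry_nonneg (n : Fin 4) (J : Fin P.d → Site P 0 → ℝ) (y : Site P k) : 0 ≤ opEntry P k G n J y := by
  fin_cases n
  · show 0 ≤ cubeSup P k y (dir0 P) (fun ν => opK0 P G (J ν))
    exact cubeSup_nonneg y _ _
  · show 0 ≤ cubeSup P k y (dir0 P, dir0 P) (fun p : Fin P.d × Fin P.d => opKD P k G p.1 (J p.2))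
    exact cubeSup_nonneg y _ _
  · show 0 ≤ cubeSup P k y () (fun _ : Unit => opDiv P k G J)
    exact cubeSup_nonneg y _ _
  · show 0 ≤ cubeSup P k y (dir0 P) (fun ν => opKL P k G (J ν))
    exact cubeSup_nonneg y _ _

/-- `e4 ≥ 0`. [cite: Balaban1984PropagatorsI, (1.112) p.36] -/
theorem opE4_nonneg (J : Fin P.d → Site P 0 → ℝ) (y : Site P k) : 0 ≤ opE4 P k G J y := cubeSup_nonneg y _ _

/-- `‖ζ∇GJ‖_α ≥ 0`. [cite: Balaban1984PropagatorsI, (1.111) p.35] -/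
theorem opHD_nonneg (J : Fin P.d → Site P 0 → ℝ) (α : ℝ) (ζ : Site P 0 → ℝ) : 0 ≤ opHD P k G J α ζ :=
  (holN_nonneg P k α _).trans (Finset.le_sup' (fun p : Fin P.d × Fin P.d => holN P k α
    (fun x => ζ x * opKD P k G p.1 (J p.2) x)) (Finset.mem_univ (dir0 P, dir0 P)))

/-- `‖ζG∇*J‖_α ≥ 0`. [cite: Balaban1984PropagatorsI, (1.111) p.35] -/
theorem opHS_nonneg (J : Fin P.d → Site P 0 → ℝ) (α : ℝ) (ζ : Site P 0 → ℝ) : 0 ≤ opHS P k G J α ζ := holN_nonneg P k α _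

/-- `‖ζ∇G∇*J‖_α ≥ 0`. [cite: Balaban1984PropagatorsI, (1.113) p.36] -/
theorem opH2_nonneg (J : Fin P.d → Site P 0 → ℝ) (α : ℝ) (ζ : Site P 0 → ℝ) : 0 ≤ opH2 P k G J α ζ :=
  (holN_nonneg P k α _).trans (Finset.le_sup' (fun μ : Fin P.d => holN P k α (fun x => ζ x * opDD P k G J μ x))
    (Finset.mem_univ (dir0 P)))

/-- `h1 ≥ 0` (both branches). [cite: Balaban1984PropagatorsI, (1.111) p.35] -/
theorem opSetting_h1_nonneg (Gi : Matrix (Site P 0) (Site P 0) ℝ) (J : Fin P.d → Site P 0 → ℝ) (α : ℝ)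
    (ζ : Site P 0 → ℝ) : 0 ≤ (opSetting P k G Gi).h1 J α ζ := by
  rw [opSetting_h1]
  split_ifs
  · exact (opHD_nonneg G J α ζ).trans (le_max_left _ _)
  · exact le_rfl

/-- Every L² quantity of (1.89) is non-negative. [cite: Balaban1984PropagatorsI, (1.89) p.33] -/
theorem opL2_nonneg (n : Fin 6) (J : Fin P.d → Site P 0 → ℝ) : 0 ≤ opL2 P k G n J := by
  fin_cases n
  · exact l2Fam_nonneg P k (fun ν => G *ᵥ J ν)
  · exact l2Fam_nonneg P k (fun p : Fin P.d × Fin P.d => (dEta P k p.1 * G) *ᵥ J p.2)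
  · exact l2Fam_nonneg P k (fun _ : Unit => opDiv P k G J)
  · exact l2Fam_nonneg P k (opDD P k G J)
  · exact l2Fam_nonneg P k (fun p : (Fin P.d × Fin P.d) × Fin P.d => (dEta P k p.1.1 * dEta P k p.1.2 * G) *ᵥ J p.2)
  · exact le_refl (0 : ℝ)

/-- Every localized L² quantity of (1.114) is non-negative. [cite: Balaban1984PropagatorsI, (1.114) p.36] -/
theorem opL2loc_nonneg (n : Fin 6) (J : Fin P.d → Site P 0 → ℝ) (ζ : Site P 0 → ℝ) : 0 ≤ opL2loc P k G n J ζ := by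
  fin_cases n
  · exact l2Fam_nonneg P k (fun ν x => ζ x * (G *ᵥ J ν) x)
  · exact l2Fam_nonneg P k (fun (p : Fin P.d × Fin P.d) x => ζ x * ((dEta P k p.1 * G) *ᵥ J p.2) x)
  · exact l2Fam_nonneg P k (fun (_ : Unit) x => ζ x * opDiv P k G J x)
  · exact l2Fam_nonneg P k (fun μ x => ζ x * opDD P k G J μ x)
  · exact l2Fam_nonneg P k (fun (p : (Fin P.d × Fin P.d) × Fin P.d) x =>
      ζ x * ((dEta P k p.1.1 * dEta P k p.1.2 * G) *ᵥ J p.2) x)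
  · exact le_refl (0 : ℝ)

/-- The sixth members (2-tensor sources) carry no content on this carrier: `l2loc 5 = 0` (DIVERGENCE, module docstring).
[cite: Balaban1984PropagatorsI, (1.114) p.36] -/
theorem opL2loc_five (J : Fin P.d → Site P 0 → ℝ) (ζ : Site P 0 → ℝ) : opL2loc P k G 5 J ζ = 0 := rfl

/-- The sixth member of (1.89) carries no content on this carrier: `l2op 5 = 0`. [cite: Balaban1984PropagatorsI, (1.89) p.33] -/
theorem opL2_five (J : Fin P.d → Site P 0 → ℝ) : opL2 P k G 5 J = 0 := rfl

/-- A pointwise bound |(GJ_ν)(x)| ≤ b on Δ̃(y), all ν, bounds the entry n = 0. [cite: Balaban1984PropagatorsI, (1.110) p.35] -/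
theorem opEntry_zero_le (J : Fin P.d → Site P 0 → ℝ) (y : Site P k) {b : ℝ}
    (h : ∀ ν x, inCube P k x y → |opK0 P G (J ν) x| ≤ b) : opEntry P k G 0 J y ≤ b := by
  show cubeSup P k y (dir0 P) (fun ν => opK0 P G (J ν)) ≤ b
  exact cubeSup_le fun ν x hx => h ν x hx

/-- A pointwise bound |(∂_λGJ_ν)(x)| ≤ b on Δ̃(y), all λ, ν, bounds the entry n = 1. [cite: Balaban1984PropagatorsI, (1.110) p.35] -/
theorem opEntry_one_le (J : Fin P.d → Site P 0 → ℝ) (y : Site P k) {b : ℝ}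
    (h : ∀ μ ν x, inCube P k x y → |opKD P k G μ (J ν) x| ≤ b) : opEntry P k G 1 J y ≤ b := by
  show cubeSup P k y (dir0 P, dir0 P) (fun p : Fin P.d × Fin P.d => opKD P k G p.1 (J p.2)) ≤ b
  exact cubeSup_le fun p x hx => h p.1 p.2 x hx

/-- A pointwise bound |(G∇*J)(x)| ≤ b on Δ̃(y) bounds the entry n = 2. [cite: Balaban1984PropagatorsI, (1.110) p.35] -/
theorem opEntry_two_le (J : Fin P.d → Site P 0 → ℝ) (y : Site P k) {b : ℝ}
    (h : ∀ x, inCube P k x y → |opDiv P k G J x| ≤ b) : opEntry P k G 2 J y ≤ b := by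
  show cubeSup P k y () (fun _ : Unit => opDiv P k G J) ≤ b
  exact cubeSup_le fun _ x hx => h x hx

/-- A pointwise bound |(ΔGJ_ν)(x)| ≤ b on Δ̃(y), all ν, bounds the entry n = 3. [cite: Balaban1984PropagatorsI, (1.110) p.35] -/
theorem opEntry_three_le (J : Fin P.d → Site P 0 → ℝ) (y : Site P k) {b : ℝ}
    (h : ∀ ν x, inCube P k x y → |opKL P k G (J ν) x| ≤ b) : opEntry P k G 3 J y ≤ b := by
  show cubeSup P k y (dir0 P) (fun ν => opKL P k G (J ν)) ≤ b
  exact cubeSup_le fun ν x hx => h ν x hx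

/-- A pointwise bound |(∇G∇*J)_μ(x)| ≤ b on Δ̃(y), all μ, bounds e4. [cite: Balaban1984PropagatorsI, (1.112) p.36] -/
theorem opE4_le (J : Fin P.d → Site P 0 → ℝ) (y : Site P k) {b : ℝ}
    (h : ∀ μ x, inCube P k x y → |opDD P k G J μ x| ≤ b) : opE4 P k G J y ≤ b :=
  cubeSup_le fun μ x hx => h μ x hx

/-- The entries evaluated from below: |(GJ_ν)(x)| ≤ e 0 J y for x ∈ Δ̃(y). [cite: Balaban1984PropagatorsI, (1.110) p.35] -/
theorem opK0_le_opEntry (J : Fin P.d → Site P 0 → ℝ) (y : Site P k) (ν : Fin P.d) {x : Site P 0}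
    (hx : inCube P k x y) : |opK0 P G (J ν) x| ≤ opEntry P k G 0 J y :=
  le_cubeSup (dir0 P) (fun ν => opK0 P G (J ν)) ν hx

/-- |(∂_μGJ_ν)(x)| ≤ e 1 J y for x ∈ Δ̃(y). [cite: Balaban1984PropagatorsI, (1.110) p.35] -/
theorem opKD_le_opEntry (J : Fin P.d → Site P 0 → ℝ) (y : Site P k) (μ ν : Fin P.d) {x : Site P 0}
    (hx : inCube P k x y) : |opKD P k G μ (J ν) x| ≤ opEntry P k G 1 J y :=
  le_cubeSup (dir0 P, dir0 P) (fun p : Fin P.d × Fin P.d => opKD P k G p.1 (J p.2)) (μ, ν) hx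

/-- |(G∇*J)(x)| ≤ e 2 J y for x ∈ Δ̃(y). [cite: Balaban1984PropagatorsI, (1.110) p.35] -/
theorem opDiv_le_opEntry (J : Fin P.d → Site P 0 → ℝ) (y : Site P k) {x : Site P 0} (hx : inCube P k x y) :
    |opDiv P k G J x| ≤ opEntry P k G 2 J y :=
  le_cubeSup () (fun _ : Unit => opDiv P k G J) () hx

/-- |(ΔGJ_ν)(x)| ≤ e 3 J y for x ∈ Δ̃(y). [cite: Balaban1984PropagatorsI, (1.110) p.35] -/
theorem opKL_le_opEntry (J : Fin P.d → Site P 0 → ℝ) (y : Site P k) (ν : Fin P.d) {x : Site P 0}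
    (hx : inCube P k x y) : |opKL P k G (J ν) x| ≤ opEntry P k G 3 J y :=
  le_cubeSup (dir0 P) (fun ν => opKL P k G (J ν)) ν hx

/-- |(∇G∇*J)_μ(x)| ≤ e4 J y for x ∈ Δ̃(y). [cite: Balaban1984PropagatorsI, (1.112) p.36] -/
theorem opDD_le_opE4 (J : Fin P.d → Site P 0 → ℝ) (y : Site P k) (μ : Fin P.d) {x : Site P 0}
    (hx : inCube P k x y) : |opDD P k G J μ x| ≤ opE4 P k G J y :=
  le_cubeSup (dir0 P) (opDD P k G J) μ hx

/-- ‖ζ·∂_μGJ_ν‖_α ≤ hD. [cite: Balaban1984PropagatorsI, (1.111) p.35] -/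
theorem holN_le_opHD (J : Fin P.d → Site P 0 → ℝ) (α : ℝ) (ζ : Site P 0 → ℝ) (μ ν : Fin P.d) :
    holN P k α (fun x => ζ x * opKD P k G μ (J ν) x) ≤ opHD P k G J α ζ :=
  Finset.le_sup' (fun p : Fin P.d × Fin P.d => holN P k α (fun x => ζ x * opKD P k G p.1 (J p.2) x))
    (Finset.mem_univ (μ, ν))

/-- hD ≤ b from the bounds ‖ζ·∂_μGJ_ν‖_α ≤ b for all μ, ν. [cite: Balaban1984PropagatorsI, (1.111) p.35] -/
theorem opHD_le (J : Fin P.d → Site P 0 → ℝ) (α : ℝ) (ζ : Site P 0 → ℝ) {b : ℝ}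
    (h : ∀ μ ν, holN P k α (fun x => ζ x * opKD P k G μ (J ν) x) ≤ b) : opHD P k G J α ζ ≤ b :=
  Finset.sup'_le _ _ fun p _ => h p.1 p.2

/-- ‖ζ·(∇G∇*J)_μ‖_α ≤ h2. [cite: Balaban1984PropagatorsI, (1.113) p.36] -/
theorem holN_le_opH2 (J : Fin P.d → Site P 0 → ℝ) (α : ℝ) (ζ : Site P 0 → ℝ) (μ : Fin P.d) :
    holN P k α (fun x => ζ x * opDD P k G J μ x) ≤ opH2 P k G J α ζ :=
  Finset.le_sup' (fun μ : Fin P.d => holN P k α (fun x => ζ x * opDD P k G J μ x)) (Finset.mem_univ μ)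

/-- h2 ≤ b from the bounds ‖ζ·(∇G∇*J)_μ‖_α ≤ b for all μ. [cite: Balaban1984PropagatorsI, (1.113) p.36] -/
theorem opH2_le (J : Fin P.d → Site P 0 → ℝ) (α : ℝ) (ζ : Site P 0 → ℝ) {b : ℝ}
    (h : ∀ μ, holN P k α (fun x => ζ x * opDD P k G J μ x) ≤ b) : opH2 P k G J α ζ ≤ b :=
  Finset.sup'_le _ _ fun μ _ => h μ

end Bounds

/-! ### The kernels at B5's top level k = K (η = ε) and for G = G′: the tree's quantities -/

/-- At k = K the kernel `opKD` of G′ = G^ε_K is `B5GpSettingTorus.ED` (= [2]'s (D^η_μG_Kf)(x)). [cite: Balaban1984PropagatorsI, (1.110) p.35] -/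
theorem opKD_top_gp {a msq : ℝ} (ha : 0 < a) (hm : 0 ≤ msq) (hK : 1 ≤ P.K) (μ : Fin P.d) (f : Site P 0 → ℝ)
    (x : Site P 0) : opKD P P.K (Grs P a msq P.K) μ f x = ED P a msq P.K μ f x := by
  rw [opKD, dEta_top, Grs_top ha hm hK, ED_top]

/-- At k = K the kernel `opK0` of G′ is `B5Display135Torus.E0`. [cite: Balaban1984PropagatorsI, (1.110) p.35] -/
theorem opK0_top_gp {a msq : ℝ} (ha : 0 < a) (hm : 0 ≤ msq) (hK : 1 ≤ P.K) (f : Site P 0 → ℝ) (x : Site P 0) :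
    opK0 P (Grs P a msq P.K) f x = E0 P a msq P.K f x := by
  rw [opK0, Grs_top ha hm hK, E0_top]

/-- For every level 1 ≤ k the kernel `opK0` of G′_k is `E0` (`B5Display135Torus.E0_eq`). [cite: Balaban1984PropagatorsI, (1.110) p.35] -/
theorem opK0_gp {a msq : ℝ} (ha : 0 < a) (hm : 0 ≤ msq) {k : ℕ} (hk : 1 ≤ k) (f : Site P 0 → ℝ) (x : Site P 0) :
    opK0 P (Grs P a msq k) f x = E0 P a msq k f x := by
  rw [opK0, B5Display135Torus.E0_eq ha hm hk]

/-- For every level 1 ≤ k the kernel `opK1` of G′_k is `E1` (`B5Display135Torus.E1_eq`). [cite: Balaban1984PropagatorsI, (1.110) p.35] -/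
theorem opK1_gp {a msq : ℝ} (ha : 0 < a) (hm : 0 ≤ msq) {k : ℕ} (hk : 1 ≤ k) (ν : Fin P.d) (f : Site P 0 → ℝ)
    (x : Site P 0) : opK1 P k (Grs P a msq k) ν f x = E1 P a msq k ν f x := by
  rw [opK1, dEta, B5Display135Torus.E1_eq ha hm hk]

/-! ## §5 The families of record -/

section Families

/-- **The family of G₀-settings over an arbitrary index**: member i is the direction-`μ i` setting on the torus `P i` at its
top level (k = K, η = ε). [cite: Balaban1984PropagatorsI, Prop. 1.2 p.35 («uniformly in k, T_η»), (1.132)–(1.133) p.39] -/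
def famG0 {I : Type} (Pf : I → Params) (μ : ∀ i, Fin (Pf i).d) (a msq : ℝ) : I → B5.Setting :=
  fun i => g0Setting (Pf i) a msq (Pf i).K (μ i)

/-- The signs of the family. [cite: Balaban1984PropagatorsI, (1.108)–(1.109) p.35] -/
theorem modelSigns_famG0 {I : Type} (Pf : I → Params) (μ : ∀ i, Fin (Pf i).d) (a msq : ℝ) (i : I) :
    B5FromB4.ModelSigns (famG0 Pf μ a msq i) :=
  modelSigns_g0Setting a msq _ _

/-- **The index of record**: a torus of the family with P.d = d, P.L = L, 1 ≤ K (p38's `B5DictTorusEta.GpTopIdx`) AND a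
direction μ. [cite: Balaban1984PropagatorsI, Prop. 1.2 p.35] -/
structure G0TopIdx (d L : ℕ) where
  P : Params
  hPd : P.d = d
  hPL : P.L = L
  hK : 1 ≤ P.K
  μ : Fin P.d

/-- **THE FAMILY OF RECORD FOR G₀** over `G0TopIdx d L`: all tori of the family (every m, every K ≥ 1) and all directions.
[cite: Balaban1984PropagatorsI, Prop. 1.2 p.35, (1.132)–(1.133) p.39] -/
def famG0Top (d L : ℕ) (a msq : ℝ) : G0TopIdx d L → B5.Setting := fun i => g0Setting i.P a msq i.P.K i.μ

/-- The family of record is `famG0` at the index of record (definitional). [cite: Balaban1984PropagatorsI, Prop. 1.2 p.35] -/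
theorem famG0Top_eq (d L : ℕ) (a msq : ℝ) :
    famG0Top d L a msq = famG0 (fun i : G0TopIdx d L => i.P) (fun i => i.μ) a msq := rfl

/-- The signs of the family of record. [cite: Balaban1984PropagatorsI, (1.108)–(1.109) p.35] -/
theorem modelSigns_famG0Top (d L : ℕ) (a msq : ℝ) (i : G0TopIdx d L) : B5FromB4.ModelSigns (famG0Top d L a msq i) :=
  modelSigns_g0Setting a msq _ _

/-- **The G′-family on the same index** (the partner of `famG0` in the transfer): member i is `gpSetting (P i) a m² (P i).K (o i)`
— the family of `B5Prop12GpTorus.gp_blocks_top'`, for which (1.110)–(1.113) hold hypothesis-free. [cite: Balaban1984PropagatorsI, (1.133) p.39] -/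
def famGpOf {I : Type} (Pf : I → Params) (o : ∀ i, L2Half (Pf i)) (a msq : ℝ) : I → B5.Setting :=
  fun i => gpSetting (Pf i) a msq (Pf i).K (o i)

end Families

end B5G0SettingTorus

end

end Literature.MathematicalPhysics.QuantumFieldTheory.Balaban1983to89
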